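import Summits.HodgeConjecture.HodgeCM.Model.WeilCentralCoinvariants_2

/-! PORT of `HodgeCM/Model/WeilCentralCoinvariants.lean` (HodgeCMPerL run 82) — part 3: continuation of `Summits.HodgeConjecture.HodgeCM.Model.WeilCentralCoinvariants_2` (split at a top-level declaration boundary by port_pkg.py; scope re-opened below; declarations unchanged). -/

-- port_pkg: scope re-opened for this part (file-level context, then the namespace/section stack open at the cut)
set_option autoImplicit false
noncomputable section
namespace HodgeCM
namespace WeilCoinv
open Literature.NumberTheory.GelbartRogawski1991 Literature.NumberTheory.GelbartRogawski1991.UnitaryDualPair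
open Literature.NumberTheory.Automorphic Literature.NumberTheory.Weil1964
open scoped Kronecker
open NumberField
variable (F E : Type) [Field F] [NumberField F] [Field E] [NumberField E] [Algebra F E]
variable (c : E ≃ₐ[F] E) (N M : ℕ) {n : ℕ} (e : Fin N × Fin M ≃ Fin n)
variable (JV : Matrix (Fin N) (Fin N) E) (JW : Matrix (Fin M) (Fin M) E)
variable {TV : Matrix (Fin N) (Fin N) F} {TW : Matrix (Fin M) (Fin M) F}
variable [Algebra.IsQuadraticExtension F E] {δ : E} (hcδ : c δ = -δ) (hδ : δ ≠ 0) {d : F}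
  (hd : δ * δ = algebraMap F E d) (hV : TV.IsSymm) (hW : TW.IsSymm) (hVd : IsUnit TV.det) (hWd : IsUnit TW.det)
  (hJV : JV = TV.map (algebraMap F E)) (hJW : JW = TW.map (algebraMap F E))
  {s : UnitaryGroup.adelicPair F E c N M JV JW →* adelicMpCont F (Fin n) (adelicGram F e TV TW)}
variable (χ : UnitaryGroup.finAdelic F E c M JW →* ℂˣ)
section Twist
open Literature.RepresentationTheory
variable (ĉ : UnitaryGroup.adelicPair F E c N M JV JW →* ℂˣ)
section FinTwist
open scoped SchwartzMap TensorProduct Classical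
open NumberField.mixedEmbedding IsDedekindDomain
/-- **The finite Weil representation of a twisted splitting**:
`ω_f^{s ⊗ ĉ}(k, u) = ĉ((1,k) ⊗ 1) · ĉ(1 ⊗ (1,u)) • ω_f^{s}(k, u) = (twistCharV ĉ k · twistCharW ĉ u) • ω_f^{s}(k, u)`
(the finite factor is unique, `finRepMp_unique`, and `ω((s ⊗ ĉ)_pair(ι k, ι u)) (Φ_∞ ⊗ f) = Φ_∞ ⊗ (ĉ • ω_f^s(k,u) f)` by
§2a). [cite: Weil1964, Chap. III n° 37–38 p. 188–190; GelbartRogawski1991, §3.1 Remark p. 457] -/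
theorem finPairRep_twist (hs : (splittingDatum F E c N M e JV JW hcδ hδ hd hV hW hVd hWd hJV hJW).IsCompatible s)
    (hs' : (splittingDatum F E c N M e JV JW hcδ hδ hd hV hW hVd hWd hJV hJW).IsCompatible
      (adelicMpCont.twist F (Fin n) (adelicGram F e TV TW) s ĉ))
    (q : UnitaryGroup.finAdelic F E c N JV × UnitaryGroup.finAdelic F E c M JW) (f : FinSB F (Fin N × Fin M)) :
    finPairRep F E c N M e JV JW hcδ hδ hd hV hW hVd hWd hJV hJW hs' q f =
      ((twistCharV F E c N M JV JW ĉ q.1 * twistCharW F E c N M JV JW ĉ q.2 : ℂˣ) : ℂ) •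
        finPairRep F E c N M e JV JW hcδ hδ hd hV hW hVd hWd hJV hJW hs q f := by
  have hΦ₀ : unitSchwartz F (Fin N × Fin M) ≠ 0 := by
    intro h0
    have h1 := unitSchwartz_apply_zero (F := F) (ι := Fin N × Fin M)
    rw [h0] at h1
    simp at h1
  have hB : ∀ g : FinSB F (Fin N × Fin M),
      adelicMpCont.omega F (Fin N × Fin M) _
          (((pairSmall₁ F E c N M e JV JW (adelicMpCont.twist F (Fin n) (adelicGram F e TV TW) s ĉ)).comp
            (finPairToAdelic F E c N M JV JW)) q)
          (piSchwartzBruhatEquiv F (Fin N × Fin M) (unitSchwartz F (Fin N × Fin M) ⊗ₜ[ℂ] g)) =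
        piSchwartzBruhatEquiv F (Fin N × Fin M) (unitSchwartz F (Fin N × Fin M) ⊗ₜ[ℂ]
          ((((ĉ (UnitaryGroup.adelicInl F E c N M JV JW (finPairToAdelic F E c N M JV JW q).1 *
                UnitaryGroup.adelicInr F E c N M JV JW (finPairToAdelic F E c N M JV JW q).2) : ℂˣ) : ℂ) •
            finPairRep F E c N M e JV JW hcδ hδ hd hV hW hVd hWd hJV hJW hs q) g)) := fun g => by
    simp only [MonoidHom.coe_comp, Function.comp_apply, omega_pairSmall₁_twist_apply,
      omega_pairSmall₁_finPairToAdelic_tmul F E c N M e JV JW hcδ hδ hd hV hW hVd hWd hJV hJW hs q, LinearMap.smul_apply,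
      TensorProduct.tmul_smul, LinearEquiv.map_smul]
  have huniq := finRepMp_unique (isUnit_kronecker_map F N hVd hWd)
    ((pairSmall₁ F E c N M e JV JW (adelicMpCont.twist F (Fin n) (adelicGram F e TV TW) s ĉ)).comp
      (finPairToAdelic F E c N M JV JW))
    (fun p a w => proj_pairSmall₁_finAdelic_apply_archVec F E c N M e JV JW hcδ hδ hd hV hW hVd hWd hJV hJW hs'
      p.1 p.2 a w) q hΦ₀ hB
  show finRepMp (isUnit_kronecker_map F N hVd hWd)
      ((pairSmall₁ F E c N M e JV JW (adelicMpCont.twist F (Fin n) (adelicGram F e TV TW) s ĉ)).comp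
        (finPairToAdelic F E c N M JV JW))
      (fun p a w => proj_pairSmall₁_finAdelic_apply_archVec F E c N M e JV JW hcδ hδ hd hV hW hVd hWd hJV hJW hs'
        p.1 p.2 a w) q f = _
  rw [← huniq, LinearMap.smul_apply, map_mul ĉ]
  rfl

end FinTwist

/-- `U(J_V)`-member: `ω_f^{s ⊗ ĉ}(k, 1) = twistCharV ĉ k • ω_f^{s}(k, 1)`. [folklore] -/
theorem finPairRepV_twist (hs : (splittingDatum F E c N M e JV JW hcδ hδ hd hV hW hVd hWd hJV hJW).IsCompatible s)
    (hs' : (splittingDatum F E c N M e JV JW hcδ hδ hd hV hW hVd hWd hJV hJW).IsCompatible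
      (adelicMpCont.twist F (Fin n) (adelicGram F e TV TW) s ĉ))
    (k : UnitaryGroup.finAdelic F E c N JV) (f : FinSB F (Fin N × Fin M)) :
    finPairRepV F E c N M e JV JW hcδ hδ hd hV hW hVd hWd hJV hJW hs' k f =
      ((twistCharV F E c N M JV JW ĉ k : ℂˣ) : ℂ) • finPairRepV F E c N M e JV JW hcδ hδ hd hV hW hVd hWd hJV hJW hs k f := by
  have h := finPairRep_twist F E c N M e JV JW hcδ hδ hd hV hW hVd hWd hJV hJW ĉ hs hs' (k, 1) f
  rw [map_one, mul_one] at h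
  exact h

/-- `U(J_W)`-member: `ω_f^{s ⊗ ĉ}(1, u) = twistCharW ĉ u • ω_f^{s}(1, u)`. [folklore] -/
theorem finPairRepW_twist (hs : (splittingDatum F E c N M e JV JW hcδ hδ hd hV hW hVd hWd hJV hJW).IsCompatible s)
    (hs' : (splittingDatum F E c N M e JV JW hcδ hδ hd hV hW hVd hWd hJV hJW).IsCompatible
      (adelicMpCont.twist F (Fin n) (adelicGram F e TV TW) s ĉ))
    (u : UnitaryGroup.finAdelic F E c M JW) (f : FinSB F (Fin N × Fin M)) :
    finPairRepW F E c N M e JV JW hcδ hδ hd hV hW hVd hWd hJV hJW hs' u f =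
      ((twistCharW F E c N M JV JW ĉ u : ℂˣ) : ℂ) • finPairRepW F E c N M e JV JW hcδ hδ hd hV hW hVd hWd hJV hJW hs u f := by
  have h := finPairRep_twist F E c N M e JV JW hcδ hδ hd hV hW hVd hWd hJV hJW ĉ hs hs' (1, u) f
  rw [map_one, one_mul] at h
  exact h

/-- **Equal relation submodules**: for `χ' = twistCharW ĉ · χ` (pointwise) the `χ'`-relations of `ω_f^{s ⊗ ĉ}` are the
`χ`-relations of `ω_f^{s}` (same submodule of `𝒮((𝔸_F^∞)^{NM})`). [folklore] -/
theorem ker_weilCoinv_twist (hs : (splittingDatum F E c N M e JV JW hcδ hδ hd hV hW hVd hWd hJV hJW).IsCompatible s)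
    (hs' : (splittingDatum F E c N M e JV JW hcδ hδ hd hV hW hVd hWd hJV hJW).IsCompatible
      (adelicMpCont.twist F (Fin n) (adelicGram F e TV TW) s ĉ))
    {χ χ' : UnitaryGroup.finAdelic F E c M JW →* ℂˣ} (hχ : ∀ u, χ' u = twistCharW F E c N M JV JW ĉ u * χ u) :
    TwistedCoinv.ker (finPairRepW F E c N M e JV JW hcδ hδ hd hV hW hVd hWd hJV hJW hs') χ' =
      TwistedCoinv.ker (finPairRepW F E c N M e JV JW hcδ hδ hd hV hW hVd hWd hJV hJW hs) χ :=
  TwistedCoinv.ker_eq_of_forall_smul (twistCharW F E c N M JV JW ĉ)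
    (fun u f => finPairRepW_twist F E c N M e JV JW hcδ hδ hd hV hW hVd hWd hJV hJW ĉ hs hs' u f) hχ

/-- **`Ω(s ⊗ ĉ, χ') ≃ Ω(s, χ)` as vector spaces** for `χ' = twistCharW ĉ · χ`: the two quotients of `𝒮((𝔸_F^∞)^{NM})` by
the SAME submodule (`Submodule.quotEquivOfEq`; `mk f ↦ mk f`). [folklore] -/
def weilCoinvTwistEquiv (hs : (splittingDatum F E c N M e JV JW hcδ hδ hd hV hW hVd hWd hJV hJW).IsCompatible s)
    (hs' : (splittingDatum F E c N M e JV JW hcδ hδ hd hV hW hVd hWd hJV hJW).IsCompatible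
      (adelicMpCont.twist F (Fin n) (adelicGram F e TV TW) s ĉ))
    {χ χ' : UnitaryGroup.finAdelic F E c M JW →* ℂˣ} (hχ : ∀ u, χ' u = twistCharW F E c N M JV JW ĉ u * χ u) :
    TwistedCoinv.Coinv (finPairRepW F E c N M e JV JW hcδ hδ hd hV hW hVd hWd hJV hJW hs') χ' ≃ₗ[ℂ]
      TwistedCoinv.Coinv (finPairRepW F E c N M e JV JW hcδ hδ hd hV hW hVd hWd hJV hJW hs) χ :=
  Submodule.quotEquivOfEq _ _ (ker_weilCoinv_twist F E c N M e JV JW hcδ hδ hd hV hW hVd hWd hJV hJW ĉ hs hs' hχ)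

variable (hs : (splittingDatum F E c N M e JV JW hcδ hδ hd hV hW hVd hWd hJV hJW).IsCompatible s)
  (hs' : (splittingDatum F E c N M e JV JW hcδ hδ hd hV hW hVd hWd hJV hJW).IsCompatible
    (adelicMpCont.twist F (Fin n) (adelicGram F e TV TW) s ĉ))
  {χ χ' : UnitaryGroup.finAdelic F E c M JW →* ℂˣ} (hχ : ∀ u, χ' u = twistCharW F E c N M JV JW ĉ u * χ u)

/-- (Ported verbatim from the HodgeCMPerL package; no docstring in the source.) -/
@[simp] theorem weilCoinvTwistEquiv_mk (f : FinSB F (Fin N × Fin M)) :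
    weilCoinvTwistEquiv F E c N M e JV JW hcδ hδ hd hV hW hVd hWd hJV hJW ĉ hs hs' hχ
        (TwistedCoinv.mk (finPairRepW F E c N M e JV JW hcδ hδ hd hV hW hVd hWd hJV hJW hs') χ' f) =
      TwistedCoinv.mk (finPairRepW F E c N M e JV JW hcδ hδ hd hV hW hVd hWd hJV hJW hs) χ f := rfl

/-- (Ported verbatim from the HodgeCMPerL package; no docstring in the source.) -/
@[simp] theorem weilCoinvTwistEquiv_symm_mk (f : FinSB F (Fin N × Fin M)) :
    (weilCoinvTwistEquiv F E c N M e JV JW hcδ hδ hd hV hW hVd hWd hJV hJW ĉ hs hs' hχ).symm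
        (TwistedCoinv.mk (finPairRepW F E c N M e JV JW hcδ hδ hd hV hW hVd hWd hJV hJW hs) χ f) =
      TwistedCoinv.mk (finPairRepW F E c N M e JV JW hcδ hδ hd hV hW hVd hWd hJV hJW hs') χ' f := rfl

/-- **The intertwining law**: `E (Ω(s ⊗ ĉ, χ')(k) x) = twistCharV ĉ k • Ω(s, χ)(k) (E x)` — under `E`, `Ω(s ⊗ ĉ, χ')` is
`Ω(s, χ)` with the `U(J_V)(𝔸_{F,f})`-action twisted by `twistCharV ĉ`. [cite: GelbartRogawski1991, §3.1 Remark p. 457] -/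
theorem weilCoinvTwistEquiv_weilCoinv (k : UnitaryGroup.finAdelic F E c N JV)
    (x : TwistedCoinv.Coinv (finPairRepW F E c N M e JV JW hcδ hδ hd hV hW hVd hWd hJV hJW hs') χ') :
    weilCoinvTwistEquiv F E c N M e JV JW hcδ hδ hd hV hW hVd hWd hJV hJW ĉ hs hs' hχ
        (weilCoinv F E c N M e JV JW hcδ hδ hd hV hW hVd hWd hJV hJW χ' hs' k x) =
      ((twistCharV F E c N M JV JW ĉ k : ℂˣ) : ℂ) •
        weilCoinv F E c N M e JV JW hcδ hδ hd hV hW hVd hWd hJV hJW χ hs k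
          (weilCoinvTwistEquiv F E c N M e JV JW hcδ hδ hd hV hW hVd hWd hJV hJW ĉ hs hs' hχ x) := by
  obtain ⟨f, rfl⟩ := TwistedCoinv.mk_surjective _ χ' x
  have h := finPairRep_twist F E c N M e JV JW hcδ hδ hd hV hW hVd hWd hJV hJW ĉ hs hs' (k, 1) f
  rw [map_one, mul_one] at h
  simp only [weilCoinv_mk, weilCoinvTwistEquiv_mk, h, map_smul]

/-- the same in `SeesawScalar.twist` currency: `E ∘ Ω(s ⊗ ĉ, χ')(k) = twist (twistCharV ĉ) (Ω(s, χ)) k ∘ E`. [folklore] -/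
theorem weilCoinvTwistEquiv_weilCoinv_eq_twist (k : UnitaryGroup.finAdelic F E c N JV)
    (x : TwistedCoinv.Coinv (finPairRepW F E c N M e JV JW hcδ hδ hd hV hW hVd hWd hJV hJW hs') χ') :
    weilCoinvTwistEquiv F E c N M e JV JW hcδ hδ hd hV hW hVd hWd hJV hJW ĉ hs hs' hχ
        (weilCoinv F E c N M e JV JW hcδ hδ hd hV hW hVd hWd hJV hJW χ' hs' k x) =
      SeesawScalar.twist (twistCharV F E c N M JV JW ĉ) (weilCoinv F E c N M e JV JW hcδ hδ hd hV hW hVd hWd hJV hJW χ hs) k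
        (weilCoinvTwistEquiv F E c N M e JV JW hcδ hδ hd hV hW hVd hWd hJV hJW ĉ hs hs' hχ x) :=
  (weilCoinvTwistEquiv_weilCoinv F E c N M e JV JW hcδ hδ hd hV hW hVd hWd hJV hJW ĉ hs hs' hχ k x).trans
    (SeesawScalar.twist_apply _ _ _ _).symm

end Twist

end WeilCoinv
end HodgeCM

end
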